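import Summits.Ventures.PercRepro.S1ConeTwo
import Summits.Ventures.PercRepro.S1ConeFour
import Summits.Ventures.PercRepro.S1CapNineTen
import Summits.Ventures.PercRepro.S1ChainCellTenSevenCaps

/-!
# PercRepro — THE CAP (P9) AT `45`, AND THE CELL `(10, 7)` (p2, gen 25; SUBCLAIM-S1 §6.9 (xii) T5)

An `e`-free matroid of nullity `6` with `≤ 13` points, `9` triangles and every point on `≥ 2` triangles has
exactly `10` points, `a ≤ 4` points of degree `2`, and otherwise degrees `3` and `4` (S1CapNineTen); through a point
of degree `2 / 3 / 4` there are at most `34 − 7 = 27` / `19 − 6 = 13` / `8 − 5 = 3` four-circuits (S1ConeTwo /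
S1ConeNineteen / S1ConeFour). With `a + b + c = 10` and `2a + 3b + 4c = 27`, the double count gives
`4·s₄ ≤ 27a + 13b + 3c = 160 + 4a ≤ 176`, so **`s₄ ≤ 44 ≤ 45`** — the cap (P9) at `45`, and with the cap table
of S1ChainCellTenSevenCaps **THE CELL `(10, 7)` CLOSES**: `c025_core_ten_seven`.

* **`cap_nine_of_nullity_six`** — (P9) at `45` (in fact `44`);
* **`c025_core_ten_seven`** — `RLS` at `(10, 4)` on every `e`-free core of rank `10` with `17` points.
Axioms: standard.
-/

open scoped Matroid

namespace PercRepro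

namespace S1

open Set

variable {α : Type}

open Classical in
/-- **(P9) AT `45`**: an `e`-free matroid of nullity `6` with `≤ 13` points, `9` triangles and every point on `≥ 2`
triangles has at most `45` (indeed `44`) four-circuits. -/
theorem cap_nine_of_nullity_six (N : Matroid α) [N.Finite]
    (hfree : ∀ e ∈ N.E, ∃ A ⊆ N.E \ {e}, e ∉ N.closure A ∧ e ∉ N.closure ((N.E \ {e}) \ A))
    (hd : N.E.encard = N.eRank + ((6 : ℕ) : ℕ∞)) (hn : N.E.ncard ≤ 13)
    (h9 : {C : Set α | N.IsCircuit C ∧ C.ncard = 3}.ncard = 9)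
    (hdeg : ∀ x ∈ N.E, 2 ≤ {C : Set α | N.IsCircuit C ∧ C.ncard = 3 ∧ x ∈ C}.ncard) :
    {C : Set α | N.IsCircuit C ∧ C.ncard = 4}.ncard ≤ 45 := by
  have hEfin : N.E.Finite := N.ground_finite
  -- the core facts
  have hL : ∀ e ∈ N.E, ¬ N.IsLoop e := ThmN.not_isLoop_of_free N hfree
  have hs : ∀ e ∈ N.E, ∀ f ∈ N.E, e ≠ f → N.eRk {e, f} = 2 := by
    intro e he f hf hef
    have h2 : (2 : ℕ∞) ≤ N.eRk {e, f} :=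
      ThmN.two_le_eRk_of_two_le_ncard_of_free N hfree (pair_subset he hf) (by rw [ncard_pair hef])
    have h3 : N.eRk {e, f} ≤ 2 := by
      have := N.eRk_le_encard {e, f}
      rwa [encard_pair hef] at this
    exact le_antisymm h3 h2
  have hcirc' : ∀ C, N.IsCircuit C → 3 ≤ C.encard := ThmN.three_le_encard_of_circuit N hL hs
  have hcirc : ∀ C, N.IsCircuit C → 3 ≤ C.ncard := by
    intro C hC
    have h := hcirc' C hC
    rw [← (hEfin.subset hC.subset_ground).cast_ncard_eq] at h
    exact_mod_cast h
  have hC1 : ∀ L ⊆ N.E, N.eRk L = 2 → L.ncard ≤ 3 := by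
    intro L hL' hr
    have := ThmN.ncard_add_one_le_two_pow_of_eRk_le N hL hfree 2 L hL' hr.le
    omega
  have hC2 : ∀ P ⊆ N.E, N.eRk P ≤ 3 → P.ncard ≤ 6 := fun P hP hr =>
    ThmN.ncard_le_six_of_eRk_le_three_of_free N hfree hP hr
  -- ten points, the degree structure
  obtain ⟨hn10, hD₂4, hdeg4⟩ := ncard_eq_ten_of_nine N hfree hd hn h9 hdeg
  -- the finsets and the double counts
  have hmem𝒯 : ∀ C, C ∈ (finite_triangles N).toFinset ↔ N.IsCircuit C ∧ C.ncard = 3 := fun C => by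
    rw [Set.Finite.mem_toFinset]; rfl
  have h𝒯card : (finite_triangles N).toFinset.card = 9 := by
    rw [← h9]; exact (Set.ncard_eq_toFinset_card _ (finite_triangles N)).symm
  have hmemF : ∀ C, C ∈ (finite_fourCircuits N).toFinset ↔ N.IsCircuit C ∧ C.ncard = 4 := fun C => by
    rw [Set.Finite.mem_toFinset]; rfl
  have hFcard : (finite_fourCircuits N).toFinset.card = {C : Set α | N.IsCircuit C ∧ C.ncard = 4}.ncard :=
    (Set.ncard_eq_toFinset_card _ (finite_fourCircuits N)).symm
  have hmemE : ∀ x, x ∈ hEfin.toFinset ↔ x ∈ N.E := fun x => Set.Finite.mem_toFinset _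
  have hEcard : hEfin.toFinset.card = 10 := by rw [← Set.ncard_eq_toFinset_card _ hEfin, hn10]
  have hsum3 : ∑ x ∈ hEfin.toFinset, ((finite_triangles N).toFinset.filter (fun C => x ∈ C)).card = 27 := by
    rw [sum_card_filter_mem N _ 3 (fun C hC => ⟨((hmem𝒯 C).1 hC).1.subset_ground, ((hmem𝒯 C).1 hC).2⟩), h𝒯card]
  have hsum4 : ∑ x ∈ hEfin.toFinset, ((finite_fourCircuits N).toFinset.filter (fun C => x ∈ C)).card =
      4 * (finite_fourCircuits N).toFinset.card :=
    sum_card_filter_mem N _ 4 (fun C hC => ⟨((hmemF C).1 hC).1.subset_ground, ((hmemF C).1 hC).2⟩)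
  have hdegset : ∀ x, ((finite_triangles N).toFinset.filter (fun C => x ∈ C)).card =
      {C : Set α | N.IsCircuit C ∧ C.ncard = 3 ∧ x ∈ C}.ncard := by
    intro x
    rw [← Set.ncard_coe_finset]
    congr 1
    ext C
    simp only [Finset.coe_filter, hmem𝒯, Set.mem_setOf_eq]
    tauto
  have hfourset : ∀ x, ((finite_fourCircuits N).toFinset.filter (fun C => x ∈ C)).card =
      {C : Set α | N.IsCircuit C ∧ C.ncard = 4 ∧ x ∈ C}.ncard := by
    intro x
    rw [← Set.ncard_coe_finset]
    congr 1
    ext C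
    simp only [Finset.coe_filter, hmemF, Set.mem_setOf_eq]
    tauto
  -- the triangles avoiding `x` number `9 − deg x`
  have havoid : ∀ x ∈ N.E, {C : Set α | N.IsCircuit C ∧ C.ncard = 3 ∧ x ∉ C}.ncard +
      {C : Set α | N.IsCircuit C ∧ C.ncard = 3 ∧ x ∈ C}.ncard = 9 := by
    intro x hx
    have hAfin : {C : Set α | N.IsCircuit C ∧ C.ncard = 3 ∧ x ∈ C}.Finite :=
      (finite_triangles N).subset (fun C hC => ⟨hC.1, hC.2.1⟩)
    have hBfin : {C : Set α | N.IsCircuit C ∧ C.ncard = 3 ∧ x ∉ C}.Finite :=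
      (finite_triangles N).subset (fun C hC => ⟨hC.1, hC.2.1⟩)
    have hdisj : Disjoint {C : Set α | N.IsCircuit C ∧ C.ncard = 3 ∧ x ∈ C}
        {C : Set α | N.IsCircuit C ∧ C.ncard = 3 ∧ x ∉ C} := by
      rw [Set.disjoint_left]
      rintro C ⟨-, -, h⟩ ⟨-, -, h'⟩
      exact h' h
    rw [add_comm, ← Set.ncard_union_eq hdisj hAfin hBfin, ← h9]
    congr 1
    ext C
    simp only [Set.mem_setOf_eq, Set.mem_union]
    tauto
  -- the per-point bounds by degree
  have hpoint : ∀ x ∈ N.E,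
      ({C : Set α | N.IsCircuit C ∧ C.ncard = 3 ∧ x ∈ C}.ncard = 2 →
        {C : Set α | N.IsCircuit C ∧ C.ncard = 4 ∧ x ∈ C}.ncard ≤ 27) ∧
      ({C : Set α | N.IsCircuit C ∧ C.ncard = 3 ∧ x ∈ C}.ncard = 3 →
        {C : Set α | N.IsCircuit C ∧ C.ncard = 4 ∧ x ∈ C}.ncard ≤ 13) ∧
      ({C : Set α | N.IsCircuit C ∧ C.ncard = 3 ∧ x ∈ C}.ncard = 4 →
        {C : Set α | N.IsCircuit C ∧ C.ncard = 4 ∧ x ∈ C}.ncard ≤ 3) := by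
    intro x hx
    have hav := havoid x hx
    refine ⟨fun hdx => ?_, fun hdx => ?_, fun hdx => ?_⟩
    · -- degree `2`
      obtain ⟨L₁, L₂, h12, hLeq⟩ := Set.ncard_eq_two.1 hdx
      have hmemx : ∀ C, C ∈ ThmN.trianglesThrough N x ↔ C = L₁ ∨ C = L₂ := by
        intro C
        have : C ∈ ThmN.trianglesThrough N x ↔ C ∈ ({L₁, L₂} : Set (Set α)) := by rw [← hLeq]; rfl
        rw [this]; simp
      have h34 := ncard_fourCircuits_through_add_triangles_avoiding_le_two N hC1 hC2 hcirc hn10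
        ((hmemx L₁).2 (Or.inl rfl)) ((hmemx L₂).2 (Or.inr rfl)) h12 (fun C hC => (hmemx C).1 hC)
      omega
    · -- degree `3`
      obtain ⟨L₁, L₂, L₃, h12, h13, h23, hLeq⟩ := Set.ncard_eq_three.1 hdx
      have hmemx : ∀ C, C ∈ ThmN.trianglesThrough N x ↔ C = L₁ ∨ C = L₂ ∨ C = L₃ := by
        intro C
        have : C ∈ ThmN.trianglesThrough N x ↔ C ∈ ({L₁, L₂, L₃} : Set (Set α)) := by rw [← hLeq]; rfl
        rw [this]; simp
      have h19 := ncard_fourCircuits_through_add_triangles_avoiding_le N hC1 hC2 hcirc hn10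
        ((hmemx L₁).2 (Or.inl rfl)) ((hmemx L₂).2 (Or.inr (Or.inl rfl))) ((hmemx L₃).2 (Or.inr (Or.inr rfl)))
        h12 h13 h23 (fun C hC => (hmemx C).1 hC)
      omega
    · -- degree `4`
      obtain ⟨L₁, t, hL₁t, hins, ht3⟩ := Set.eq_insert_of_ncard_eq_succ hdx
      obtain ⟨L₂, L₃, L₄, h23, h24, h34, hteq⟩ := Set.ncard_eq_three.1 ht3
      rw [hteq] at hins hL₁t
      have h12 : L₁ ≠ L₂ := fun h => hL₁t (by rw [h]; simp)
      have h13 : L₁ ≠ L₃ := fun h => hL₁t (by rw [h]; simp)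
      have h14 : L₁ ≠ L₄ := fun h => hL₁t (by rw [h]; simp)
      have hmemx : ∀ C, C ∈ ThmN.trianglesThrough N x ↔ C = L₁ ∨ C = L₂ ∨ C = L₃ ∨ C = L₄ := by
        intro C
        have : C ∈ ThmN.trianglesThrough N x ↔ C ∈ ({L₁, L₂, L₃, L₄} : Set (Set α)) := by rw [hins]; rfl
        rw [this]; simp
      have h8 := ncard_fourCircuits_through_add_triangles_avoiding_le_four N hC1 hC2 hn10
        ((hmemx L₁).2 (Or.inl rfl)) ((hmemx L₂).2 (Or.inr (Or.inl rfl)))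
        ((hmemx L₃).2 (Or.inr (Or.inr (Or.inl rfl)))) ((hmemx L₄).2 (Or.inr (Or.inr (Or.inr rfl))))
        h12 h13 h14 h23 h24 h34 (fun C hC => (hmemx C).1 hC)
      omega
  -- the bound per point, as a function of the degree
  set g : α → ℕ := fun x => (if {C : Set α | N.IsCircuit C ∧ C.ncard = 3 ∧ x ∈ C}.ncard = 2 then 27 else
    (if {C : Set α | N.IsCircuit C ∧ C.ncard = 3 ∧ x ∈ C}.ncard = 3 then 13 else 3)) with hg
  have hbound : ∀ x ∈ hEfin.toFinset, ((finite_fourCircuits N).toFinset.filter (fun C => x ∈ C)).card ≤ g x := by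
    intro x hx
    have hxE := (hmemE x).1 hx
    have hp := hpoint x hxE
    have h2 := hdeg x hxE
    have h4 := hdeg4 x hxE
    rw [hfourset, hg]
    simp only
    split_ifs with ha hb
    · exact hp.1 ha
    · exact hp.2.1 hb
    · exact hp.2.2 (by omega)
  have hle := Finset.sum_le_sum hbound
  rw [hsum4] at hle
  -- the three degree classes
  have hsplit2 := Finset.sum_filter_add_sum_filter_not hEfin.toFinset
    (fun x => {C : Set α | N.IsCircuit C ∧ C.ncard = 3 ∧ x ∈ C}.ncard = 2) g
  have hsplit3 := Finset.sum_filter_add_sum_filter_not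
    (hEfin.toFinset.filter (fun x => ¬ {C : Set α | N.IsCircuit C ∧ C.ncard = 3 ∧ x ∈ C}.ncard = 2))
    (fun x => {C : Set α | N.IsCircuit C ∧ C.ncard = 3 ∧ x ∈ C}.ncard = 3) g
  have hA : ∑ x ∈ hEfin.toFinset.filter (fun x => {C : Set α | N.IsCircuit C ∧ C.ncard = 3 ∧ x ∈ C}.ncard = 2),
      g x = 27 * (hEfin.toFinset.filter
        (fun x => {C : Set α | N.IsCircuit C ∧ C.ncard = 3 ∧ x ∈ C}.ncard = 2)).card := by
    have h : ∀ x ∈ hEfin.toFinset.filter (fun x => {C : Set α | N.IsCircuit C ∧ C.ncard = 3 ∧ x ∈ C}.ncard = 2),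
        g x = 27 := by
      intro x hx
      rw [hg]; simp only
      rw [if_pos (Finset.mem_filter.1 hx).2]
    rw [Finset.sum_congr rfl h, Finset.sum_const, smul_eq_mul, mul_comm]
  have hB : ∑ x ∈ (hEfin.toFinset.filter (fun x => ¬ {C : Set α | N.IsCircuit C ∧ C.ncard = 3 ∧ x ∈ C}.ncard = 2)).filter
      (fun x => {C : Set α | N.IsCircuit C ∧ C.ncard = 3 ∧ x ∈ C}.ncard = 3), g x =
      13 * ((hEfin.toFinset.filter (fun x => ¬ {C : Set α | N.IsCircuit C ∧ C.ncard = 3 ∧ x ∈ C}.ncard = 2)).filter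
        (fun x => {C : Set α | N.IsCircuit C ∧ C.ncard = 3 ∧ x ∈ C}.ncard = 3)).card := by
    have h : ∀ x ∈ (hEfin.toFinset.filter (fun x => ¬ {C : Set α | N.IsCircuit C ∧ C.ncard = 3 ∧ x ∈ C}.ncard = 2)).filter
        (fun x => {C : Set α | N.IsCircuit C ∧ C.ncard = 3 ∧ x ∈ C}.ncard = 3), g x = 13 := by
      intro x hx
      have h3 := (Finset.mem_filter.1 hx).2
      rw [hg]; simp only
      rw [if_neg (by omega), if_pos h3]
    rw [Finset.sum_congr rfl h, Finset.sum_const, smul_eq_mul, mul_comm]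
  have hC : ∑ x ∈ (hEfin.toFinset.filter (fun x => ¬ {C : Set α | N.IsCircuit C ∧ C.ncard = 3 ∧ x ∈ C}.ncard = 2)).filter
      (fun x => ¬ {C : Set α | N.IsCircuit C ∧ C.ncard = 3 ∧ x ∈ C}.ncard = 3), g x =
      3 * ((hEfin.toFinset.filter (fun x => ¬ {C : Set α | N.IsCircuit C ∧ C.ncard = 3 ∧ x ∈ C}.ncard = 2)).filter
        (fun x => ¬ {C : Set α | N.IsCircuit C ∧ C.ncard = 3 ∧ x ∈ C}.ncard = 3)).card := by
    have h : ∀ x ∈ (hEfin.toFinset.filter (fun x => ¬ {C : Set α | N.IsCircuit C ∧ C.ncard = 3 ∧ x ∈ C}.ncard = 2)).filter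
        (fun x => ¬ {C : Set α | N.IsCircuit C ∧ C.ncard = 3 ∧ x ∈ C}.ncard = 3), g x = 3 := by
      intro x hx
      have h1 := (Finset.mem_filter.1 (Finset.mem_filter.1 hx).1).2
      have h2 := (Finset.mem_filter.1 hx).2
      rw [hg]; simp only
      rw [if_neg h1, if_neg h2]
    rw [Finset.sum_congr rfl h, Finset.sum_const, smul_eq_mul, mul_comm]
  -- the cardinalities `a + b + c = 10`, `a ≤ 4`, and the degree sum `2a + 3b + 4c = 27`
  have hcard1 := Finset.card_filter_add_card_filter_not (s := hEfin.toFinset)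
    (fun x => {C : Set α | N.IsCircuit C ∧ C.ncard = 3 ∧ x ∈ C}.ncard = 2)
  have hcard2 := Finset.card_filter_add_card_filter_not
    (s := hEfin.toFinset.filter (fun x => ¬ {C : Set α | N.IsCircuit C ∧ C.ncard = 3 ∧ x ∈ C}.ncard = 2))
    (fun x => {C : Set α | N.IsCircuit C ∧ C.ncard = 3 ∧ x ∈ C}.ncard = 3)
  rw [hEcard] at hcard1
  have hdsplit2 := Finset.sum_filter_add_sum_filter_not hEfin.toFinset
    (fun x => {C : Set α | N.IsCircuit C ∧ C.ncard = 3 ∧ x ∈ C}.ncard = 2)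
    (fun x => ((finite_triangles N).toFinset.filter (fun C => x ∈ C)).card)
  have hdsplit3 := Finset.sum_filter_add_sum_filter_not
    (hEfin.toFinset.filter (fun x => ¬ {C : Set α | N.IsCircuit C ∧ C.ncard = 3 ∧ x ∈ C}.ncard = 2))
    (fun x => {C : Set α | N.IsCircuit C ∧ C.ncard = 3 ∧ x ∈ C}.ncard = 3)
    (fun x => ((finite_triangles N).toFinset.filter (fun C => x ∈ C)).card)
  have hdA : ∑ x ∈ hEfin.toFinset.filter (fun x => {C : Set α | N.IsCircuit C ∧ C.ncard = 3 ∧ x ∈ C}.ncard = 2),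
      ((finite_triangles N).toFinset.filter (fun C => x ∈ C)).card =
      2 * (hEfin.toFinset.filter (fun x => {C : Set α | N.IsCircuit C ∧ C.ncard = 3 ∧ x ∈ C}.ncard = 2)).card := by
    have h : ∀ x ∈ hEfin.toFinset.filter (fun x => {C : Set α | N.IsCircuit C ∧ C.ncard = 3 ∧ x ∈ C}.ncard = 2),
        ((finite_triangles N).toFinset.filter (fun C => x ∈ C)).card = 2 := by
      intro x hx; rw [hdegset]; exact (Finset.mem_filter.1 hx).2
    rw [Finset.sum_congr rfl h, Finset.sum_const, smul_eq_mul, mul_comm]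
  have hdB : ∑ x ∈ (hEfin.toFinset.filter (fun x => ¬ {C : Set α | N.IsCircuit C ∧ C.ncard = 3 ∧ x ∈ C}.ncard = 2)).filter
      (fun x => {C : Set α | N.IsCircuit C ∧ C.ncard = 3 ∧ x ∈ C}.ncard = 3),
      ((finite_triangles N).toFinset.filter (fun C => x ∈ C)).card =
      3 * ((hEfin.toFinset.filter (fun x => ¬ {C : Set α | N.IsCircuit C ∧ C.ncard = 3 ∧ x ∈ C}.ncard = 2)).filter
        (fun x => {C : Set α | N.IsCircuit C ∧ C.ncard = 3 ∧ x ∈ C}.ncard = 3)).card := by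
    have h : ∀ x ∈ (hEfin.toFinset.filter (fun x => ¬ {C : Set α | N.IsCircuit C ∧ C.ncard = 3 ∧ x ∈ C}.ncard = 2)).filter
        (fun x => {C : Set α | N.IsCircuit C ∧ C.ncard = 3 ∧ x ∈ C}.ncard = 3),
        ((finite_triangles N).toFinset.filter (fun C => x ∈ C)).card = 3 := by
      intro x hx; rw [hdegset]; exact (Finset.mem_filter.1 hx).2
    rw [Finset.sum_congr rfl h, Finset.sum_const, smul_eq_mul, mul_comm]
  have hdC : ∑ x ∈ (hEfin.toFinset.filter (fun x => ¬ {C : Set α | N.IsCircuit C ∧ C.ncard = 3 ∧ x ∈ C}.ncard = 2)).filter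
      (fun x => ¬ {C : Set α | N.IsCircuit C ∧ C.ncard = 3 ∧ x ∈ C}.ncard = 3),
      ((finite_triangles N).toFinset.filter (fun C => x ∈ C)).card =
      4 * ((hEfin.toFinset.filter (fun x => ¬ {C : Set α | N.IsCircuit C ∧ C.ncard = 3 ∧ x ∈ C}.ncard = 2)).filter
        (fun x => ¬ {C : Set α | N.IsCircuit C ∧ C.ncard = 3 ∧ x ∈ C}.ncard = 3)).card := by
    have h : ∀ x ∈ (hEfin.toFinset.filter (fun x => ¬ {C : Set α | N.IsCircuit C ∧ C.ncard = 3 ∧ x ∈ C}.ncard = 2)).filter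
        (fun x => ¬ {C : Set α | N.IsCircuit C ∧ C.ncard = 3 ∧ x ∈ C}.ncard = 3),
        ((finite_triangles N).toFinset.filter (fun C => x ∈ C)).card = 4 := by
      intro x hx
      have hxE := (hmemE x).1 (Finset.mem_filter.1 (Finset.mem_filter.1 hx).1).1
      have h1 := (Finset.mem_filter.1 (Finset.mem_filter.1 hx).1).2
      have h2 := (Finset.mem_filter.1 hx).2
      have h3 := hdeg x hxE
      have h4 := hdeg4 x hxE
      rw [hdegset]; omega
    rw [Finset.sum_congr rfl h, Finset.sum_const, smul_eq_mul, mul_comm]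
  rw [hsum3] at hdsplit2
  rw [← hFcard]
  omega

/-- **THE CELL `(10, 7)`**: `RLS` at `(10, 4)` on every `e`-free core of rank `10` with `17` points. -/
theorem c025_core_ten_seven (M : Matroid α) [M.Finite] (hR : M.eRank = (10 : ℕ)) (hn : M.E.ncard = 17)
    (hfree : ∀ e ∈ M.E, ∃ A ⊆ M.E \ {e}, e ∉ M.closure A ∧ e ∉ M.closure ((M.E \ {e}) \ A)) :
    ThmN.RLS M 10 4 :=
  c025_core_ten_seven_of_cap_nine' M hR hn hfree
    (fun N _ hfree' hd hn' h9 hdeg => cap_nine_of_nullity_six N hfree' hd hn' h9 hdeg)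

end S1

end PercRepro
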